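import Literature.Geometry.Kaehler.ComplexTorusCyclotomicCharpolyTwentyFour
import Literature.Geometry.Kaehler.ComplexTorusCyclotomicAutomorphismOrderSixteenHodge
import HarnessLib

/-!
# The Hodge side of the complex tori with an endomorphism of characteristic polynomial `Φ₂₄`: the primitive CM types of
# `ℚ(ζ₂₄)` have rank `5` (nondegenerate), ALL imprimitive ones rank `2`; `rank MT = 5 / 2`; the Hodge classes on every power
# of every such torus are divisor classes; the Hodge conjecture for all powers of the simple ζ₂₄-fourfolds

Layer `Literature/Geometry/Kaehler`, namespace `Literature.Geometry.Kaehler.ComplexTorus`; sequel of this seat's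
`CyclotomicCMTypeCensusTwentyFour` (FIVE families: `{1,5,7,13}` primitive; `{1,5,7,11}`, `{1,5,13,17}`, `{1,7,13,19}`, `{1,11,17,19}`
induced from `ℚ(√−6)`, `ℚ(i)`, `ℚ(√−3)`, `ℚ(√−2)` — every non-trivial stabiliser has order `4`), `ComplexTorusCyclotomicCharpolyTwentyFour`
(EXACTLY FIVE complex tori with `P_u = Φ₂₄`, one simple, four `∼ E⁴`) and the `ℚ(ζ₁₆)` / `ℚ(ζ₁₅)` / `ℚ(ζ₂₀)` Hodge files (whose
`cmTypeRank_eq_of_isAutTransform` is reused), lane `lit-hodgefound` (Track 2 foundations library), prover seat `lit-hodgefound-p10`,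
generation 33, row «A2-26(gz)» (self-proposed 2026-08-28).  THEOREMS ONLY (no definition, no named fact, no `sorry`).

THE SOURCES.  B. Dodson, Trans. AMS **283** (1984), §3.1.0 p. 11 (the rank `t(Φ)`; `n + 1` = nondegenerate) and §3.3.2 Theorem
p. 16 (a simple CM fourfold is degenerate only for `Gal(Kᶜ/ℚ) = ℤ₂ × A₄` or `ℤ₂ × S₄` — never for the abelian `ℚ(ζ₂₄)`; here by
direct count); B. Dodson, J. Algebra **107** (1987), §1.1 p. 50 (`Rank(Φ) = dim MT`); B. Moonen, Yu. Zarhin, Math. Ann. **315**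
(1999), Thm. 0.1; B. B. Gordon (1999), 5.13 and §9.3–9.4; G. Shimura (1998), §6.2 Thm. 3, §8.2 Prop. 26, §8.4; Ch. Birkenhake,
H. Lange (2004), §13.3.

## What is proved

* §1: **`five_le_cmTypeRank_of_residueSet_eq_twentyFour`** (for the type with residue set `{1,5,7,13}` the translates by the
  automorphisms of `ℂ` with cyclotomic characters `1, 5, 7, 11, 13`, read at the embeddings with exponents `5, 13, 17, 19, 23`,
  are linearly independent — an explicit `5 × 5` system), `cmTypeRank_eq_five_of_residueSet_eq_twentyFour`,
  **`cmTypeRank_eq_five_of_isPrimitive_twentyFour`**, `isNondegenerate_of_isPrimitive_twentyFour`,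
  **`isNondegenerate_iff_isPrimitive_twentyFour`**, **`cmTypeRank_eq_two_of_not_isPrimitive_twentyFour`** (ALL imprimitive types:
  rank `2`), `cmTypeRank_eq_five_iff_isPrimitive_twentyFour`.
* §2: **`isSimple_and_hodgeConjectureFor_pow_of_isPrimitive_twentyFour`**, `dim_eq_four_of_isCMTypeRealisation_twentyFour`,
  `hodgeConjectureFor_of_isPrimitive_twentyFour`, **`exists_isSimple_hodgeConjectureFor_pow_twentyFour`**.
* §3: **`IsSimple.mtRank_hodgeStructure_eq_five_of_charpoly_eq_cyclotomic_twentyFour`**,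
  **`mtRank_hodgeStructure_eq_two_of_not_isSimple_of_charpoly_eq_cyclotomic_twentyFour`**,
  `mtRank_hodgeStructure_eq_five_iff_isSimple_of_charpoly_eq_cyclotomic_twentyFour`, and
  **`divisorClasses_powPeriod_eq_hodgeClasses_of_charpoly_eq_cyclotomic_twentyFour`**: `Hdg(Xᵏ) = Div(Xᵏ)` for ALL `k` and EVERY
  complex torus with an endomorphism of characteristic polynomial `Φ₂₄`.  With the `Φ₁₅`, `Φ₁₆`, `Φ₂₀` files this covers every
  complex `4`-torus carrying an endomorphism with `P_u = Φ_d`, `φ(d) = 8`, `d ∈ {15, 16, 20, 24}`; the remaining degree-`8` case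
  `Φ₃₀(X) = Φ₁₅(−X)` reduces to `Φ₁₅` by `u ↦ −u` and is not spelled out here.

## References

* [Dodson1984] B. Dodson, *The structure of Galois groups of CM-fields*, Trans. Amer. Math. Soc. 283 (1984) 1–32, §3.1.0
  p. 11, §3.3.2 Theorem p. 16 (held `paper:doi-10-2307-1999987`, read).
* [Dodson1987] B. Dodson, *On the Mumford–Tate group of an abelian variety with complex multiplication*, J. Algebra 107
  (1987), §1.1 p. 50.
* [MoonenZarhin1999LowDim] B. Moonen, Yu. Zarhin, *Hodge classes on abelian varieties of low dimension*, Math. Ann. 315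
  (1999), Thm. 0.1.
* [Gordon1999HodgeAVSurvey] B. B. Gordon, *A survey of the Hodge conjecture for abelian varieties*, Appendix B in
  J. Lewis, *A Survey of the Hodge Conjecture*, 2nd ed. (1999), 5.13, Thm. 6.4, §9.3, §9.4.
* [Kubota1965] T. Kubota, *On the field extension by complex multiplication*, Trans. AMS 118 (1965), §2 p. 115.
* [Shimura1998] G. Shimura, *Abelian Varieties with Complex Multiplication and Modular Functions*, Princeton (1998),
  §6.1 Thm. 2, §6.2 Thm. 3, §8.2 Prop. 26, §8.4 Examples (1)–(2).
* [BirkenhakeLange2004] Ch. Birkenhake, H. Lange, *Complex Abelian Varieties*, 2nd ed. (2004), §13.3.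
* [Deligne1982HodgeCycles] P. Deligne, *Hodge cycles on abelian varieties*, LNM 900 (1982), I §3, §5.
-/

noncomputable section

open scoped Classical nonZeroDivisors NumberField Manifold ContDiff MatrixGroups
open NumberField Module Polynomial CategoryTheory CategoryTheory.Limits

namespace Literature.Geometry.Kaehler

namespace ComplexTorus

-- `open scoped`: the tree's action of `Aut(ℂ)` on `Hom(K, ℂ)` by composition (`ringEquivCompAction`) is a scoped instance
open scoped Literature.NumberTheory.ComplexMultiplication
open Literature.NumberTheory.Automorphic (IsTorusSubgroup)
open Literature.AlgebraicGeometry.Motives (CMType AbelianVariety HodgeTensorFacts hodgeTensorFacts_holds)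
open Literature.AlgebraicGeometry.HodgeTheory (HodgeConjectureFor complexBetti)
open Literature.AlgebraicGeometry.VanGeemen1994 (hodgeClassSpan)
open Literature.Barriers.HodgeConjecture (divisorClassesSpan)
open Literature.NumberTheory.ComplexMultiplication (IsPrimitive translateInd translateInd_of_mem translateInd_of_not_mem
  inducedCMType exists_primitive_inducedCMType_eq_of_isCMField)
open Literature.NumberTheory.ComplexMultiplication.CMTypeLattice (periodIso basisIndex card_basisIndex_eq_finrank
  isSimple_periodIso_iff_isPrimitive)
open Literature.AlgebraicGeometry.Pohlmann1968 (cmTypeRank cmTypeRank_le IsNondegenerate isNondegenerate_iff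
  cmTypeRank_inducedCMType isNondegenerate_of_isPrimitive_of_finrank_le_six isNondegenerate_of_finrank_eq_two)
open Literature.AlgebraicGeometry.Pohlmann1968.Cyclotomic (autExp expOf exists_autExp_eq exists_expOf_eq)
open Literature.AlgebraicGeometry.ComplexMultiplication (IsCMTypeRealisation isPrimitive_ringEquiv_complex_iff
  isSimple_of_isCMTypeRealisation_of_isPrimitive)
open Literature.AlgebraicGeometry.ComplexMultiplication.CMTorus (mtRank_hodgeStructure_periodIso_eq_cmTypeRank)
open Literature.AlgebraicGeometry.ComplexMultiplication.CyclotomicCMTypeResidueSets (IsAutTransform unitResidues residueSet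
  expOf_smul expOf_mem_residueSet_iff IsAutTransform.isPrimitive_iff)
open Literature.AlgebraicGeometry.ComplexMultiplication.CyclotomicCMTypeCensusTwentyFour (exists_five_families_twentyFour
  isAutTransform_of_isPrimitive_twentyFour)

/-! ### §1 The ranks of the CM types of `ℚ(ζ₂₄)`: `5` (primitive), `2` (all imprimitive types: from `ℚ(√−6)`, `ℚ(i)`, `ℚ(√−3)`, `ℚ(√−2)`) -/

section Types

variable {K : Type} [Field K] [NumberField K]

variable [IsCyclotomicExtension {24} ℚ K]

variable (K) in
/-- `ℚ(ζ₂₄)` is a CM field (Mathlib: `ℚ(ζₙ)`, `n > 2`). No instance is registered. [folklore] -/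
private theorem isCMField_twentyFour₄₁ : IsCMField K :=
  IsCyclotomicExtension.Rat.isCMField K (S := ({24} : Set ℕ)) ⟨24, rfl, by norm_num⟩

omit [IsCyclotomicExtension {24} ℚ K] in
/-- An embedding of `K` into `ℂ` exists. [folklore] -/
private theorem nonempty_embedding₄₁ : Nonempty (K →+* ℂ) := inferInstance

/-- The indicator of a translate of `Φ`, read on exponents: `[τσ ∈ Φ] = [u(τ)·e(σ) ∈ S_Φ]`. [cite: Shimura1998, §8.4 Example (1)] -/
private theorem translateInd_eq_ite₄₁ (Φ : CMType K) (τ : ℂ ≃+* ℂ) (σ : K →+* ℂ) :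
    translateInd Φ.1 τ σ = if autExp 24 τ * expOf 24 K σ ∈ residueSet 24 Φ then (1 : ℚ) else 0 := by
  have h : τ • σ ∈ Φ.1 ↔ autExp 24 τ * expOf 24 K σ ∈ residueSet 24 Φ := by
    rw [← expOf_mem_residueSet_iff 24 Φ, expOf_smul]
  by_cases hm : autExp 24 τ * expOf 24 K σ ∈ residueSet 24 Φ
  · rw [translateInd_of_mem (h.2 hm), if_pos hm]
  · rw [translateInd_of_not_mem (fun h' => hm (h.1 h')), if_neg hm]

/-- **`Rank(Φ) ≥ 5` FOR THE TYPE `S_Φ = {1, 5, 7, 13}` OF `ℚ(ζ₂₄)`**: the translates of `Φ` by automorphisms of `ℂ` with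
cyclotomic characters `1, 5, 7, 11, 13`, evaluated at the embeddings with exponents `5, 13, 17, 19, 23`, give the matrix
`(1,1,0,0,0; 1,0,1,0,0; 0,0,0,1,0; 1,0,0,0,1; 0,1,1,1,0)`, whose rows are linearly independent over `ℚ` (the system
`g₁ + g₂ + g₄ = 0`, `g₁ + g₅ = g₂ + g₅ = g₃ + g₅ = 0`, `g₄ = 0` has only the zero solution), so five Galois translates of `Φ`
are linearly independent (Dodson's `t(Φ)`, computed on `(ℤ/24)ˣ`; no unitriangular `5 × 5` minor exists).
[cite: Dodson1984, §3.1.0 (p. 11)] [cite: Dodson1987, §1.1 (p. 50)] -/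
theorem five_le_cmTypeRank_of_residueSet_eq_twentyFour (Φ : CMType K) (hΦ : residueSet 24 Φ = {1, 5, 7, 13}) :
    5 ≤ cmTypeRank Φ := by
  classical
  have hu : ∀ i : Fin 5, ((![1, 5, 7, 11, 13] : Fin 5 → ZMod 24) i).val.Coprime 24 := by decide
  have hc : ∀ j : Fin 5, ((![5, 13, 17, 19, 23] : Fin 5 → ZMod 24) j).val.Coprime 24 := by decide
  choose τ hτ using fun i : Fin 5 => exists_autExp_eq 24 _ (hu i)
  choose σ hσ using fun j : Fin 5 => exists_expOf_eq 24 K _ (hc j)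
  let f : Fin 5 → (K →+* ℂ) → ℚ := fun i => translateInd Φ.1 (τ i)
  have hval : ∀ i j : Fin 5, f i (σ j) =
      if (![1, 5, 7, 11, 13] : Fin 5 → ZMod 24) i * (![5, 13, 17, 19, 23] : Fin 5 → ZMod 24) j ∈
        ({1, 5, 7, 13} : Finset (ZMod 24)) then (1 : ℚ) else 0 := by
    intro i j
    show translateInd Φ.1 (τ i) (σ j) = _
    rw [translateInd_eq_ite₄₁, hτ, hσ, hΦ]
  have hli : LinearIndependent ℚ f := by
    rw [Fintype.linearIndependent_iff]
    intro g hg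
    have heval : ∀ j : Fin 5, ∑ i, g i * f i (σ j) = 0 := fun j => by
      have := congrFun hg (σ j)
      simpa only [Finset.sum_apply, Pi.smul_apply, smul_eq_mul, Pi.zero_apply] using this
    have e0 := heval 0
    have e1 := heval 1
    have e2 := heval 2
    have e3 := heval 3
    have e4 := heval 4
    simp (config := { decide := true }) [Fin.sum_univ_five, hval] at e0 e1 e2 e3 e4
    intro i
    fin_cases i <;> simp <;> linarith
  have h1 : Module.finrank ℚ (Submodule.span ℚ (Set.range f)) = 5 := by
    rw [finrank_span_eq_card hli, Fintype.card_fin]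
  have h2 : Submodule.span ℚ (Set.range f) ≤
      Submodule.span ℚ (Set.range fun g : ℂ ≃+* ℂ => translateInd Φ.1 g) :=
    Submodule.span_mono (by rintro _ ⟨i, rfl⟩; exact ⟨τ i, rfl⟩)
  have h3 := Submodule.finrank_mono h2
  rw [h1] at h3
  exact h3

/-- **`Rank(Φ) = 5 = 4 + 1` for the type `{1, 5, 7, 13}`** (Kubota's bound `Rank ≤ n + 1`, `[ℚ(ζ₂₄) : ℚ] = 8`).
[cite: Dodson1984, §3.1.0 (p. 11)] [cite: Kubota1965, §2 (p. 115)] -/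
theorem cmTypeRank_eq_five_of_residueSet_eq_twentyFour (Φ : CMType K) (hΦ : residueSet 24 Φ = {1, 5, 7, 13}) :
    cmTypeRank Φ = 5 := by
  haveI := isCMField_twentyFour₄₁ K
  refine le_antisymm ?_ (five_le_cmTypeRank_of_residueSet_eq_twentyFour Φ hΦ)
  have h := cmTypeRank_le Φ
  rw [finrank_eq_eight_of_isCyclotomicExtension_twentyFour K inferInstance] at h
  exact h

omit [IsCyclotomicExtension {24} ℚ K] in
/-- **EVERY PRIMITIVE CM TYPE OF `ℚ(ζ₂₄)` HAS RANK `5`** — is NONDEGENERATE: the primitive types form one family (the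
census), the rank is constant on families, and the representative `{1,5,7,13}` has rank `5`.  Dodson's theorem for simple CM
fourfolds: degenerate only for `Gal(Kᶜ/ℚ) = ℤ₂ × A₄` or `ℤ₂ × S₄`, never for the abelian `ℚ(ζ₂₄)`; here by direct count.
[cite: Dodson1984, §3.3.2 Theorem (p. 16)] [cite: Shimura1998, §8.4 Examples (1)–(2)] -/
theorem cmTypeRank_eq_five_of_isPrimitive_twentyFour (hK : IsCyclotomicExtension {24} ℚ K) (Φ : CMType K) (φ₀ : K →+* ℂ)
    (hΦ : IsPrimitive (ℂ ≃+* ℂ) Φ.1 φ₀) : cmTypeRank Φ = 5 := by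
  obtain ⟨Φ₀, -, -, -, -, hr₀, -, -, -, -, hp₀, -⟩ := exists_five_families_twentyFour (L := K) hK φ₀
  rw [cmTypeRank_eq_of_isAutTransform (isAutTransform_of_isPrimitive_twentyFour Φ₀ Φ φ₀ hp₀ hΦ)]
  exact cmTypeRank_eq_five_of_residueSet_eq_twentyFour Φ₀ hr₀

omit [IsCyclotomicExtension {24} ℚ K] in
/-- **The primitive types of `ℚ(ζ₂₄)` are nondegenerate** (`Rank = [K:ℚ]/2 + 1`). [cite: Dodson1984, §3.3.2 Theorem (p. 16)]
[cite: Gordon1999HodgeAVSurvey, 5.13 (i)] -/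
theorem isNondegenerate_of_isPrimitive_twentyFour (hK : IsCyclotomicExtension {24} ℚ K) (Φ : CMType K) (φ₀ : K →+* ℂ)
    (hΦ : IsPrimitive (ℂ ≃+* ℂ) Φ.1 φ₀) : IsNondegenerate Φ := by
  rw [isNondegenerate_iff, finrank_eq_eight_of_isCyclotomicExtension_twentyFour K inferInstance]
  exact cmTypeRank_eq_five_of_isPrimitive_twentyFour hK Φ φ₀ hΦ

omit [IsCyclotomicExtension {24} ℚ K] in
/-- **For `ℚ(ζ₂₄)`: NONDEGENERATE ⟺ PRIMITIVE** (⟸ above; ⟹ Kubota: a nondegenerate type is primitive).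
[cite: Dodson1984, §3.3.2 Theorem (p. 16)] [cite: Kubota1965, §2 (p. 115)] -/
theorem isNondegenerate_iff_isPrimitive_twentyFour (hK : IsCyclotomicExtension {24} ℚ K) (Φ : CMType K) (φ₀ : K →+* ℂ) :
    IsNondegenerate Φ ↔ IsPrimitive (ℂ ≃+* ℂ) Φ.1 φ₀ := by
  haveI := isCMField_twentyFour₄₁ K
  exact ⟨fun h ↦ h.isPrimitive φ₀, isNondegenerate_of_isPrimitive_twentyFour hK Φ φ₀⟩

omit [IsCyclotomicExtension {24} ℚ K] in
/-- **RANK `2` FOR EVERY IMPRIMITIVE TYPE OF `ℚ(ζ₂₄)`**: a non-primitive type is induced from a type `Φ₁` of an imaginary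
QUADRATIC subfield `K₁` (`|W| = 4`, the census), and `Rank(Φ) = Rank(Φ₁) = 2/2 + 1 = 2` (CM elliptic curves are nondegenerate).
[cite: Shimura1998, §8.2 Prop. 26, §8.4 Example (2)] [cite: Dodson1987, §1.1 (p. 50)] [cite: Kubota1965, §2 (p. 115)] -/
theorem cmTypeRank_eq_two_of_not_isPrimitive_twentyFour (hK : IsCyclotomicExtension {24} ℚ K) (Φ : CMType K) (φ₀ : K →+* ℂ)
    (hΦ : ¬IsPrimitive (ℂ ≃+* ℂ) Φ.1 φ₀) : cmTypeRank Φ = 2 := by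
  haveI := isCMField_twentyFour₄₁ K
  obtain ⟨K₁, Φ₁, hCM, h₁, hp₁, -⟩ := exists_primitive_inducedCMType_eq_of_isCMField Φ
  haveI := hCM
  obtain ⟨-, h2⟩ := finrank_eq_of_inducedCMType_eq_of_not_isPrimitive_twentyFour h₁ hp₁ φ₀ hΦ
  have hnd := isNondegenerate_of_finrank_eq_two Φ₁ h2
  rw [← h₁, cmTypeRank_inducedCMType, (isNondegenerate_iff Φ₁).1 hnd, h2]

omit [IsCyclotomicExtension {24} ℚ K] in
/-- **THE RANK TABLE OF `ℚ(ζ₂₄)`: `Rank(Φ) = 5 ⟺ Φ` primitive** (otherwise `2`). [cite: Dodson1984, §3.3.2 Theorem (p. 16)]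
[cite: Shimura1998, §8.4 Examples (1)–(2)] -/
theorem cmTypeRank_eq_five_iff_isPrimitive_twentyFour (hK : IsCyclotomicExtension {24} ℚ K) (Φ : CMType K) (φ₀ : K →+* ℂ) :
    cmTypeRank Φ = 5 ↔ IsPrimitive (ℂ ≃+* ℂ) Φ.1 φ₀ := by
  refine ⟨fun h ↦ ?_, cmTypeRank_eq_five_of_isPrimitive_twentyFour hK Φ φ₀⟩
  by_contra hnp
  rw [cmTypeRank_eq_two_of_not_isPrimitive_twentyFour hK Φ φ₀ hnp] at h
  omega

/-- `rank MT(ℂ⁴/Φ(𝔞)) = Rank(Φ)` for the models of `ℚ(ζ₂₄)` (the tree's `mtRank_hodgeStructure_periodIso_eq_cmTypeRank`,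
the CM instance supplied). [cite: Dodson1987, §1.1 (p. 50)] [cite: Deligne1982HodgeCycles, I Example 3.7] -/
private theorem mtRank_hodgeStructure_periodIso_eq_cmTypeRank_twentyFour [HodgeTensorFacts.{0, 0}] (Φ : CMType K)
    (I : (FractionalIdeal (𝓞 K)⁰ K)ˣ) : (hodgeStructure (periodIso Φ I) 1).mtRank = cmTypeRank Φ := by
  haveI := isCMField_twentyFour₄₁ K
  exact mtRank_hodgeStructure_periodIso_eq_cmTypeRank Φ I

end Types

/-! ### §2 Abelian varieties of a primitive CM type of `ℚ(ζ₂₄)`: simple fourfolds satisfying the Hodge conjecture with all their powers -/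

section Varieties

variable {K : Type} [Field K] [NumberField K] [IsCyclotomicExtension {24} ℚ K]
  {A : AbelianVariety ℂ} {ι : 𝓞 K →+* End A} {θ : K →+* Module.End ℂ (complexBetti A.X 1)}

omit [IsCyclotomicExtension {24} ℚ K] in
/-- `dim A = 4` for a realisation of a CM type of `ℚ(ζ₂₄)` (`2 dim A = [K : ℚ] = 8`). [cite: Shimura1998, §6.2 Thm. 3] -/
theorem dim_eq_four_of_isCMTypeRealisation_twentyFour (hK : IsCyclotomicExtension {24} ℚ K) {Φ : CMType K} (hA : IsCMTypeRealisation Φ A ι θ) :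
    A.dim = 4 := by
  have h : A.dim = Module.finrank ℚ K / 2 := Literature.AlgebraicGeometry.Motives.schemeDim_eq_holds hA.1
  rw [h, finrank_eq_eight_of_isCyclotomicExtension_twentyFour K inferInstance]

omit [IsCyclotomicExtension {24} ℚ K] in
/-- **THE SIMPLE ζ₂₄-FOURFOLDS: SIMPLE, STABLY NONDEGENERATE, HODGE CONJECTURE ON ALL POWERS.**  Every abelian variety
`A` of a PRIMITIVE CM type `(ℚ(ζ₂₄); Φ)` is SIMPLE (Shimura §8.2 Prop. 26), has `Bᵏ(Aⁿ) ⊗ ℂ = Dᵏ(Aⁿ) ⊗ ℂ` for all `n, k`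
(the type is nondegenerate, §1; White–Hazama–Murty, tree `IsNondegenerate.hodgeClassSpan_pow_eq_divisorClassesSpan`), and
satisfies, with all its powers, the Hodge conjecture, UNCONDITIONALLY. [cite: Dodson1984, §3.3.2 Theorem (p. 16)]
[cite: Gordon1999HodgeAVSurvey, Thm. 6.4 and §9.3] [cite: Shimura1998, §8.2 Prop. 26] -/
theorem isSimple_and_hodgeConjectureFor_pow_of_isPrimitive_twentyFour (hK : IsCyclotomicExtension {24} ℚ K) (Φ : CMType K)
    (φ₀ : K →+* ℂ) (hΦ : IsPrimitive (ℂ ≃+* ℂ) Φ.1 φ₀) (hA : IsCMTypeRealisation Φ A ι θ) (n k : ℕ) :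
    A.IsSimple ∧
      hodgeClassSpan (⨁ fun _ : Fin n => A).dim (⨁ fun _ : Fin n => A).X k =
        divisorClassesSpan (⨁ fun _ : Fin n => A).X (⨁ fun _ : Fin n => A).dim k ∧
      HodgeConjectureFor (⨁ fun _ : Fin n => A).dim (⨁ fun _ : Fin n => A).X := by
  haveI := isCMField_twentyFour₄₁ K
  have hnd := isNondegenerate_of_isPrimitive_twentyFour hK Φ φ₀ hΦ
  exact ⟨isSimple_of_isCMTypeRealisation_of_isPrimitive hA φ₀ hΦ, hnd.hodgeClassSpan_pow_eq_divisorClassesSpan hA n k,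
    hnd.hodgeConjectureFor_pow hA n⟩

omit [IsCyclotomicExtension {24} ℚ K] in
/-- **The Hodge conjecture for every abelian variety of a primitive CM type of `ℚ(ζ₂₄)`** (`HodgeConjectureFor A.dim A.X`,
`A.dim = 4`), UNCONDITIONAL. [cite: Dodson1984, §3.3.2 Theorem (p. 16)] [cite: Gordon1999HodgeAVSurvey, Thm. 6.4 and §9.3] -/
theorem hodgeConjectureFor_of_isPrimitive_twentyFour (hK : IsCyclotomicExtension {24} ℚ K) (Φ : CMType K) (φ₀ : K →+* ℂ)
    (hΦ : IsPrimitive (ℂ ≃+* ℂ) Φ.1 φ₀) (hA : IsCMTypeRealisation Φ A ι θ) : HodgeConjectureFor A.dim A.X := by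
  haveI := isCMField_twentyFour₄₁ K
  exact (isNondegenerate_of_isPrimitive_twentyFour hK Φ φ₀ hΦ).hodgeConjectureFor hA

omit [IsCyclotomicExtension {24} ℚ K] in
variable (K) in
/-- **Non-vacuity (Shimura §6.2 Thm. 3, tree `exists_isCMTypeRealisation`)**: there IS a simple abelian FOURFOLD with
complex multiplication by `𝓞_{ℚ(ζ₂₄)}` of primitive type — carrying the automorphism `ζ₂₄` of order `20` — all of whose
powers satisfy the Hodge conjecture. [cite: Shimura1998, §6.2 Thm. 3, §8.4 Example (1)] [cite: Dodson1984, §3.3.2 Theorem (p. 16)] -/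
theorem exists_isSimple_hodgeConjectureFor_pow_twentyFour (hK : IsCyclotomicExtension {24} ℚ K) :
    ∃ (Φ : CMType K) (A : AbelianVariety ℂ) (ι' : 𝓞 K →+* End A) (θ' : K →+* Module.End ℂ (complexBetti A.X 1)),
      IsCMTypeRealisation Φ A ι' θ' ∧ A.IsSimple ∧ A.dim = 4 ∧
        ∀ n : ℕ, HodgeConjectureFor (⨁ fun _ : Fin n => A).dim (⨁ fun _ : Fin n => A).X := by
  haveI := isCMField_twentyFour₄₁ K
  obtain ⟨φ₀⟩ := nonempty_embedding₄₁ (K := K)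
  obtain ⟨Φ₁, -, -, -, -, -, -, -, -, -, hp₁, -⟩ := exists_five_families_twentyFour (L := K) hK φ₀
  obtain ⟨A, ι', θ', hA⟩ := Literature.AlgebraicGeometry.ComplexMultiplication.exists_isCMTypeRealisation Φ₁
  exact ⟨Φ₁, A, ι', θ', hA, (isSimple_and_hodgeConjectureFor_pow_of_isPrimitive_twentyFour hK Φ₁ φ₀ hp₁ hA 0 0).1,
    dim_eq_four_of_isCMTypeRealisation_twentyFour hK hA,
    fun n ↦ (isSimple_and_hodgeConjectureFor_pow_of_isPrimitive_twentyFour hK Φ₁ φ₀ hp₁ hA n 0).2.2⟩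

end Varieties

/-! ### §3 The pairs `(X, u)`: rank of the Mumford–Tate group and `Hdg(Xᵏ) = Div(Xᵏ)` for every complex torus with an endomorphism of characteristic polynomial `Φ₂₄` -/

section TwentyFour

variable {ι : Type} [Fintype ι] [DecidableEq ι] {E : Type} [NormedAddCommGroup E] [NormedSpace ℂ E]
  {P : (ι → ℝ) ≃L[ℝ] E}

omit [DecidableEq ι] [NormedSpace ℂ E] in
/-- `rk Λ = 8 = φ(24)` when `P_u = Φ₂₄`. [cite: BirkenhakeLange2004, §13.3] -/
private theorem card_eq_eight₄₁ [DecidableEq ι] {A : Matrix ι ι ℤ} (hP : A.charpoly = cyclotomic 24 ℤ) :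
    Fintype.card ι = 8 := by
  rw [card_eq_totient_of_charpoly_eq_cyclotomic hP]
  decide

set_option backward.isDefEq.respectTransparency false in -- Mathlib's instance
-- `IsCyclotomicExtension {24} ℚ (CyclotomicField 24 ℚ)` is keyed on `CyclotomicField.algebra`, the goal on
-- `DivisionRing.toRatAlgebra` (same workaround as `ComplexTorusCyclotomicCharpolyTwentyFour`)
/-- **`rank MT(X) = 5 = dim X + 1` FOR THE SIMPLE COMPLEX TORUS WITH AN ENDOMORPHISM OF CHARACTERISTIC POLYNOMIAL `Φ₂₄`**:
`X ≅ ℂ⁴/Φ(𝔞)` with `Φ` primitive (structure theorem; simple ⟺ primitive), `rank MT = Rank(Φ) = 5` (§1).  The simple ζ₂₄-fourfold is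
NONDEGENERATE (no exceptional Hodge classes — Dodson's theorem for simple CM fourfolds with abelian CM field).
[cite: Dodson1984, §3.3.2 Theorem (p. 16)] [cite: Dodson1987, §1.1 (p. 50)] [cite: BirkenhakeLange2004, §13.3] -/
theorem IsSimple.mtRank_hodgeStructure_eq_five_of_charpoly_eq_cyclotomic_twentyFour [HodgeTensorFacts.{0, 0}]
    (hX : ComplexTorus.IsSimple P) {A : Matrix ι ι ℤ} (hA : A ∈ endRingInt P)
    (hP : A.charpoly = cyclotomic 24 ℤ) : (hodgeStructure P 1).mtRank = 5 := by
  have hζ := IsCyclotomicExtension.zeta_spec 24 ℚ (CyclotomicField 24 ℚ)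
  obtain ⟨Φ, I, e, he, he₂, -⟩ :=
    exists_cmType_ideal_iso_of_charpoly_eq_cyclotomic hζ hA hP
  obtain ⟨φ₀⟩ : Nonempty (CyclotomicField 24 ℚ →+* ℂ) := inferInstance
  have hS : ComplexTorus.IsSimple (periodIso Φ I) := (IsIsomorphic.isSimple_iff ⟨e, he, he₂⟩).1 hX
  rw [IsIsomorphic.mtRank_hodgeStructure_eq P (periodIso Φ I) (k := 1) ⟨e, he, he₂⟩,
    mtRank_hodgeStructure_periodIso_eq_cmTypeRank_twentyFour Φ I,
    cmTypeRank_eq_five_of_isPrimitive_twentyFour (CyclotomicField.isCyclotomicExtension 24 ℚ) Φ φ₀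
      ((isSimple_periodIso_iff_isPrimitive Φ I φ₀).1 hS)]

set_option backward.isDefEq.respectTransparency false in -- see above
/-- **`rank MT(X) = 2` FOR THE NON-SIMPLE COMPLEX TORI WITH AN ENDOMORPHISM OF CHARACTERISTIC POLYNOMIAL `Φ₂₄`**: such an
`X` is `∼ E⁴` (`E = ℂ/Φ₁(𝔞₁)` a CM elliptic curve of one of `ℚ(√−6)`, `ℚ(i)`, `ℚ(√−3)`, `ℚ(√−2)`), and `rank MT` is the rank of
the type of the model `ℂ⁴/Φ(𝔞) ≅ X`, which is `2`. [cite: Dodson1987, §1.1 (p. 50)] [cite: Shimura1998, §6.2 Thm. 3, §8.4 Example (2)]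
[cite: MoonenZarhin1999LowDim, §1 (1.2)] [cite: BirkenhakeLange2004, §13.3] -/
theorem mtRank_hodgeStructure_eq_two_of_not_isSimple_of_charpoly_eq_cyclotomic_twentyFour [HodgeTensorFacts.{0, 0}]
    (hns : ¬ ComplexTorus.IsSimple P) {A : Matrix ι ι ℤ} (hA : A ∈ endRingInt P)
    (hP : A.charpoly = cyclotomic 24 ℤ) :
    (∃ (K₁ : IntermediateField ℚ (CyclotomicField 24 ℚ)) (Φ₁ : CMType K₁), finrank ℚ K₁ = 2 ∧
        ∀ I₁ : (FractionalIdeal (𝓞 K₁)⁰ K₁)ˣ,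
          ComplexTorus.IsSimple (periodIso Φ₁ I₁) ∧ IsIsogenous P (powPeriod (periodIso Φ₁ I₁) 4)) ∧
      (hodgeStructure P 1).mtRank = 2 := by
  have hζ := IsCyclotomicExtension.zeta_spec 24 ℚ (CyclotomicField 24 ℚ)
  obtain ⟨Φ, I, e, he, he₂, -⟩ := exists_cmType_ideal_iso_of_charpoly_eq_cyclotomic hζ hA hP
  have hX : IsIsomorphic P (periodIso Φ I) := ⟨e, he, he₂⟩
  obtain ⟨φ₀⟩ : Nonempty (CyclotomicField 24 ℚ →+* ℂ) := inferInstance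
  have hnp : ¬ IsPrimitive (ℂ ≃+* ℂ) Φ.1 φ₀ :=
    fun h ↦ hns (hX.isSimple_iff.2 ((isSimple_periodIso_iff_isPrimitive Φ I φ₀).2 h))
  have hmt : (hodgeStructure P 1).mtRank = cmTypeRank Φ := by
    rw [IsIsomorphic.mtRank_hodgeStructure_eq P (periodIso Φ I) (k := 1) hX,
      mtRank_hodgeStructure_periodIso_eq_cmTypeRank_twentyFour Φ I]
  refine ⟨exists_isIsogenous_pow_four_of_not_isSimple_of_charpoly_eq_cyclotomic_twentyFour hA hP hns, ?_⟩
  rw [hmt, cmTypeRank_eq_two_of_not_isPrimitive_twentyFour (CyclotomicField.isCyclotomicExtension 24 ℚ) Φ φ₀ hnp]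

/-- **`rank MT(X) = 5 ⟺ X` SIMPLE**, for a complex torus with an endomorphism of characteristic polynomial `Φ₂₄` (`5` for
the simple one, `2` otherwise). [cite: Dodson1984, §3.3.2 Theorem (p. 16)] [cite: MoonenZarhin1999LowDim, §1 (1.2)] -/
theorem mtRank_hodgeStructure_eq_five_iff_isSimple_of_charpoly_eq_cyclotomic_twentyFour [HodgeTensorFacts.{0, 0}] {A : Matrix ι ι ℤ}
    (hA : A ∈ endRingInt P) (hP : A.charpoly = cyclotomic 24 ℤ) :
    (hodgeStructure P 1).mtRank = 5 ↔ ComplexTorus.IsSimple P := by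
  refine ⟨fun h ↦ ?_, fun hX ↦ hX.mtRank_hodgeStructure_eq_five_of_charpoly_eq_cyclotomic_twentyFour hA hP⟩
  by_contra hns
  have h2 := (mtRank_hodgeStructure_eq_two_of_not_isSimple_of_charpoly_eq_cyclotomic_twentyFour hns hA hP).2
  rw [h2] at h
  omega

set_option backward.isDefEq.respectTransparency false in -- see above
/-- **THE HODGE CLASSES ON EVERY POWER OF EVERY COMPLEX TORUS WITH AN ENDOMORPHISM OF CHARACTERISTIC POLYNOMIAL `Φ₂₄`
ARE GENERATED BY DIVISOR CLASSES**: `Hdg(Xᵏ) = Div(Xᵏ)` for all `k` (so the Hodge conjecture holds for all powers of the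
four ζ₂₄-fourfolds).  Simple `X`: an abelian variety with Mumford–Tate torus and `rank MT = 5 = dim + 1` (§1 and
`IsAbelianVariety.forall_powPeriod_divisorClasses_eq_hodgeClasses_iff_mtRank_eq_card…`).  Non-simple `X`: `X ∼ E⁴` with `E` a SIMPLE CM elliptic curve, an abelian variety (a factor of a power isogenous to the
abelian variety `X`), with a Mumford–Tate torus; «`Hdg = Div` on all powers» holds for it (`dim ≤ 3`, simple, of CM type) and is
transported along `X ∼ E⁴`. [cite: MoonenZarhin1999LowDim, Thm. 0.1] [cite: Dodson1984, §3.3.2 Theorem (p. 16)]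
[cite: Gordon1999HodgeAVSurvey, §9.3 and 7.6] [cite: BirkenhakeLange2004, §13.3] -/
theorem divisorClasses_powPeriod_eq_hodgeClasses_of_charpoly_eq_cyclotomic_twentyFour {A : Matrix ι ι ℤ} (hA : A ∈ endRingInt P)
    (hP : A.charpoly = cyclotomic 24 ℤ) (k p : ℕ) :
    divisorClasses (powPeriod P k) p = hodgeClasses (powPeriod P k) p := by
  haveI : HodgeTensorFacts.{0, 0} := hodgeTensorFacts_holds.{0, 0}
  have hXav := isAbelianVariety_of_charpoly_eq_cyclotomic hA hP
  by_cases hX : ComplexTorus.IsSimple P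
  · have hcard := card_eq_eight₄₁ hP
    haveI : Nonempty ι := Fintype.card_pos_iff.1 (by omega)
    exact (hXav.forall_powPeriod_divisorClasses_eq_hodgeClasses_iff_mtRank_eq_card_of_isSimple_of_isTorusSubgroup_mumfordTateGroupC
      hX (isTorusSubgroup_mumfordTateGroupC_of_charpoly_eq_cyclotomic hA hP)).2
      (by rw [hX.mtRank_hodgeStructure_eq_five_of_charpoly_eq_cyclotomic_twentyFour hA hP, hcard]) k p
  · obtain ⟨K₁, Φ₁, h2, hI⟩ := exists_isIsogenous_pow_four_of_not_isSimple_of_charpoly_eq_cyclotomic_twentyFour hA hP hX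
    obtain ⟨hS₁, hiso⟩ := hI 1
    have hY : IsAbelianVariety (periodIso Φ₁ 1) :=
      (isAbelianVariety_powPeriod_iff _ four_pos).1 ((IsIsogenous.isAbelianVariety_iff _ _ hiso).1 hXav)
    have hcard : Fintype.card (basisIndex (1 : (FractionalIdeal (𝓞 K₁)⁰ K₁)ˣ)) = 2 := by
      rw [card_basisIndex_eq_finrank, h2]
    haveI : Nonempty (basisIndex (1 : (FractionalIdeal (𝓞 K₁)⁰ K₁)ˣ)) := Fintype.card_pos_iff.1 (by omega)
    exact (forall_powPeriod_divisorClasses_eq_hodgeClasses_iff_of_isIsogenous_powPeriod hY four_pos hiso).2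
      (fun k p ↦ hY.divisorClasses_powPeriod_eq_hodgeClasses_of_isSimple_of_card_le_six_of_isTorusSubgroup_mumfordTateGroupC
        hS₁ (isTorusSubgroup_mumfordTateGroupC_periodIso Φ₁ 1) (by omega) k p) k p

end TwentyFour

end ComplexTorus

end Literature.Geometry.Kaehler

end
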